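import Literature.MathematicalPhysics.QuantumFieldTheory.BalabanImbrieJaffe1984to88.BIJ88Sect5StatementsPart4

/-!
# `BalabanImbrieJaffe1984to88.BIJ88TaylorSplit5614` — T. Bałaban, J. Imbrie, A. Jaffe, *Effective action and cluster
properties of the abelian Higgs model*, Commun. Math. Phys. **114** (1988) 257–315 [BalabanImbrieJaffe1988], §5.6
*Expansion with Respect to the Fluctuation Field*, p. 288: the two displays numbered **(5.6.14)** — the low-order part
`R̃^{(k)}` of the action and the split `F_{k,loc} = F^{(m̄)}_{k,loc} + F̃_{k,loc}` of the observable along the interpolation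
`e′ ↦ ũ_{k+1}e^{ie′e_kηθ_kH_{k,loc}A^{(k)}}` — TYPED as Taylor data of a one-parameter family, with the order bookkeeping PROVED

statement-level skeleton of published theorems with citation tags; proofs where landed; nothing here is a claim about the Yang–Mills mass gap

PDF held: `paper:balaban1988-cmp114-bij-abelian-higgs-effective-action` (journal page = PDF page + 256).  Render read this
session: p. 288 = PDF 32 (`pages/original-p032-x2.png` of the p02 seat, G4 decode of the scan).

**What the paper prints (p. 288, verbatim).**  After the summary identity (5.6.13) (*"… + R^{(k)}(u_{k+1}, θ_kH_{k,loc}A^{(k)})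
+ Σ_□ W₁^{(k)}(□). (5.6.13) The tildes on φ and ψ indicate the presence of the phase factors. Here W₁^{(k)}(□) is localized near □,
an r(e_k)-cube in Λ₂^{(k)}, and |W₁^{(k)}(□)| ≦ e_k^{n̄−1−α}."*): *"If we define R̃^{(k)}(ũ_{k+1}, θ_kH_{k,loc}A^{(k)}) =
Σ_{n=1}^{n̄} [dⁿ/de′ⁿ (½aL^{−2}‖ψ − Q(ũ_{k+1}e^{ie′e_kηθ_kH_{k,loc}A^{(k)}})φ‖² + ½⟨Λ₈^{(k−1)′}φ, Δ_{k,loc}(…)Λ₈^{(k−1)′}φ⟩ +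
𝒫_{k,loc}(Λ₈^{(k−1)}, φ, …))]_{e′=0}, (5.6.14) then R^{(k)} can be obtained by replacing propagators G_k(□, ũ_{k+1}) with
G_{k,loc}(ũ_{k+1}) and eliminating extra kernels ζ″_k explicitly (not in G_{k,loc}(ũ_{k+1})). In a similar fashion we put
F_{k,loc}(X_σ) = F^{(m̄)}_{k,loc}(X_σ) + F̃_{k,loc}(X_σ), (5.6.14) where F^{(m̄)}_{k,loc}(X_σ) is defined by replacing G_k(□, ũ_{k+1}), ζ″_k in
Σ_{m=0}^{m̄} [d^m/de′^m F_{k,loc}(X_σ, ũ_{k+1}e^{ie′e_kηθ_kH_{k,loc}A^{(k)}})]_{e′=0}. All remainder terms are in F̃_{k,loc}(X_σ), and we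
have |F̃_{k,loc}(X_σ)| ≦ c(F)."*  (The number (5.6.14) is printed twice; earlier on the page: *"Any term involving w₁ or w₂, and
terms of higher than n̄-th order in e_k are irrelevant and will be treated separately. The lower order terms are polynomials in
A^{(k)}."*)

**What is reproduced here (kernel-checked, zero `sorry`, no named facts).**  The one-parameter families are taken as functions
`S, F : ℝ → E` of `e′` (`E` a real normed space; print: the action bracket of (5.6.14)₁, resp. the localized observable
`F_{k,loc}(X_σ, ũ_{k+1}e^{ie′…})`, along the interpolation from `ũ_{k+1}` (`e′ = 0`) to `ũ_{k+1}ũ` (`e′ = 1`, (5.6.6)));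
`e′`-derivatives are Mathlib's `iteratedDerivWithin` on `[0, 1]`, as in r16's treatment of (5.14.2)
(`BIJ88Sect5StatementsPart4.pertP`).
* DEFINITIONS (bodies = the printed sums, with the Taylor weights — reading (i)): **`Rtilde S n̄`** `= Σ_{n=1}^{n̄} (1/n!)
  [dⁿS/de′ⁿ]_{e′=0}` (= `R̃^{(k)}`), **`Fmbar F m̄`** `= Σ_{m=0}^{m̄} (1/m!) [d^mF/de′^m]_{e′=0}` (= `F^{(m̄)}_{k,loc}`), **`Ftilde F m̄`**
  `= F(1) − F^{(m̄)}` (= `F̃_{k,loc}`, *"all remainder terms"*).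
* `eq5614` — the printed split `F_{k,loc} = F^{(m̄)}_{k,loc} + F̃_{k,loc}` at `e′ = 1`; `Fmbar_eq_taylorWithinEval` (`F^{(m̄)}` IS the
  Taylor polynomial of order `m̄` at `0` evaluated at `1`); `Fmbar_eq_add_Rtilde` (`F^{(m̄)} = F(0) + R̃`-shape: order `0` + orders
  `1…m̄`); `Rtilde_eq_neg_pertP` (`R̃` is r16's `−𝒫̃` of (5.14.2) for the same family — one Taylor apparatus for both sections).
* **`Ftilde_eq_integral`** — *"All remainder terms are in F̃"*: for `F` of class `C^{m̄+1}` along the interpolation,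
  `F̃ = ∫₀¹ ((1−t)^{m̄}/m̄!) d^{m̄+1}F/de′^{m̄+1}(t) dt` (Mathlib's `taylor_integral_remainder`).
* **`split_S`** — the order bookkeeping behind (5.6.13): `S(1) = S(0) + R̃ + ∫₀¹((1−t)^{n̄}/n̄!) d^{n̄+1}S(t) dt` (value at the
  full field = value at `ũ_{k+1}` + the orders `1…n̄` + the *"higher than n̄-th order"* remainder that (5.6.13) files under `W₁`).
* **`norm_Ftilde_le`** — the SHAPE of *"|F̃_{k,loc}(X_σ)| ≦ c(F)"*: a bound `C` on the `(m̄+1)`-st `e′`-derivative on `[0,1]` gives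
  `‖F̃‖ ≤ C/m̄!` (Mathlib's `taylor_mean_remainder_bound`).

**Readings (declared).**  (i) TRANSCRIPTION NOTE (recorded, not adjudicated; GAPS G-C2-11, §5 owner r16 may renumber/rule): both
printed sums of (5.6.14) carry NO Taylor weights (`Σ_n [dⁿ/de′ⁿ …]_{e′=0}`); they are typed WITH the weights `1/n!`, `1/m!` — AS
DERIVED: (5.6.13) is an identity whose remainder `Σ_□W₁^{(k)}(□)` is of order `> n̄` in `e_k` only if `R^{(k)}` collects the Taylor
terms of orders `1…n̄` of the `e′`-family at `e′ = 1`, and likewise `F̃` is small only if `F^{(m̄)}` is the Taylor polynomial; the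
sister display (5.14.2) p. 308 prints the weight `1/α!` explicitly.  (ii) `R^{(k)}` itself (*"obtained by replacing propagators …
and eliminating extra kernels ζ″_k"*) and the localized `F^{(m̄)}_{k,loc}` (*"defined by replacing G_k(□, ũ_{k+1}), ζ″_k in …"*) are
further LOCALIZATIONS of `R̃`, `Σ_m …` — not modelled; the file types the `e′`-Taylor data they are built from.  (iii) real
parameter `e′ ∈ [0, 1]`, one-sided derivatives at the endpoints (`iteratedDerivWithin … (uIcc 0 1)`); values in any real normed
space `E` (complete where an integral is taken), so complex-valued observables are covered.

**What is NOT claimed.**  The identity (5.6.13) and its ingredients (5.6.6)–(5.6.12) (r16's `BIJ88Sect5StatementsPart3/Part4`: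
`eq566`, `covAvg`/`F2`, `eq5610`, `eq5612`), the bound `|W₁^{(k)}(□)| ≦ e_k^{n̄−1−α}`, the constant `c(F)` (which the paper gets from
the inductive field bounds and the analyticity of `F_{k,loc}` in the fields — here only the Taylor-remainder mechanism with an
abstract derivative bound `C`), the localizations of reading (ii); anything of B1–B16.  NOT summit progress; NOT continuum; NOT
Clay.  Imports: r16's `BIJ88Sect5StatementsPart4` (for `pertP`); no Summits import; sub-namespace `…BIJ88TaylorSplit5614`; modifies
nothing.  Cell `lit-balaban` Phase 2, seat p02 gen 4; row C2.Eq5.6.14 (owner r16; DEPGRAPH §2e.2 free board) «absent» → typed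
(defs) + kernel proved.
-/

noncomputable section

open scoped BigOperators
open Set

namespace Literature.MathematicalPhysics.QuantumFieldTheory.BalabanImbrieJaffe1984to88.BIJ88TaylorSplit5614

variable {E : Type*} [NormedAddCommGroup E] [NormedSpace ℝ E]

/-! ## (5.6.14)₁: `R̃^{(k)}` -/

/-- **`R̃^{(k)}`** (5.6.14)₁ p. 288 [PDF 32], verbatim: *"R̃^{(k)}(ũ_{k+1}, θ_kH_{k,loc}A^{(k)}) = Σ_{n=1}^{n̄} [dⁿ/de′ⁿ (½aL^{−2}‖ψ −
Q(ũ_{k+1}e^{ie′e_kηθ_kH_{k,loc}A^{(k)}})φ‖² + ½⟨Λ₈^{(k−1)′}φ, Δ_{k,loc}(…)Λ₈^{(k−1)′}φ⟩ + 𝒫_{k,loc}(Λ₈^{(k−1)}, φ, …))]_{e′=0}"* — for the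
action family `S : e′ ↦ (…)` the sum of its Taylor terms of orders `1 … n̄` at `e′ = 0` (weights `1/n!`: reading (i); index written
`n + 1`, `n < n̄`). [cite: BalabanImbrieJaffe1988, (5.6.14) p.288] -/
def Rtilde (S : ℝ → E) (nbar : ℕ) : E :=
  ∑ n ∈ Finset.range nbar, ((1 : ℝ) / (n + 1).factorial) • iteratedDerivWithin (n + 1) S (Set.uIcc 0 1) 0

/-- `R̃` for a real family is r16's `−𝒫̃` of (5.14.2) (`BIJ88Sect5StatementsPart4.pertP`): one Taylor apparatus serves (5.6.14) and
(5.14.2). [cite: BalabanImbrieJaffe1988, (5.6.14) p.288] -/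
theorem Rtilde_eq_neg_pertP (S : ℝ → ℝ) (nbar : ℕ) : Rtilde S nbar = -BIJ88Sect5StatementsPart4.pertP S nbar := by
  rw [Rtilde, BIJ88Sect5StatementsPart4.pertP, ← Finset.sum_neg_distrib]
  refine Finset.sum_congr rfl fun n _ => ?_
  rw [smul_eq_mul]
  ring

/-! ## (5.6.14)₂: `F_{k,loc} = F^{(m̄)}_{k,loc} + F̃_{k,loc}` -/

/-- **`F^{(m̄)}_{k,loc}`** (5.6.14)₂ p. 288, verbatim: *"F^{(m̄)}_{k,loc}(X_σ) is defined by … Σ_{m=0}^{m̄} [d^m/de′^m F_{k,loc}(X_σ,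
ũ_{k+1}e^{ie′e_kηθ_kH_{k,loc}A^{(k)}})]_{e′=0}"* — the Taylor terms of orders `0 … m̄` at `e′ = 0` of the observable family
`F : e′ ↦ F_{k,loc}(X_σ, …)` (weights `1/m!`: reading (i)). [cite: BalabanImbrieJaffe1988, (5.6.14) p.288] -/
def Fmbar (F : ℝ → E) (mbar : ℕ) : E :=
  ∑ m ∈ Finset.range (mbar + 1), ((1 : ℝ) / m.factorial) • iteratedDerivWithin m F (Set.uIcc 0 1) 0

/-- **`F̃_{k,loc}`** (5.6.14)₂ p. 288: *"All remainder terms are in F̃_{k,loc}(X_σ)"* — the remainder of the observable at the full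
field `e′ = 1`. [cite: BalabanImbrieJaffe1988, (5.6.14) p.288] -/
def Ftilde (F : ℝ → E) (mbar : ℕ) : E := F 1 - Fmbar F mbar

/-- **(5.6.14)₂** p. 288, verbatim: *"F_{k,loc}(X_σ) = F^{(m̄)}_{k,loc}(X_σ) + F̃_{k,loc}(X_σ)"* (at the full field `e′ = 1`).
[cite: BalabanImbrieJaffe1988, (5.6.14) p.288] -/
theorem eq5614 (F : ℝ → E) (mbar : ℕ) : F 1 = Fmbar F mbar + Ftilde F mbar := by
  rw [Ftilde, add_sub_cancel]

/-- `F^{(m̄)}` is the Taylor polynomial of order `m̄` of the `e′`-family at `0`, evaluated at `e′ = 1` (Mathlib `taylorWithinEval`).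
[cite: BalabanImbrieJaffe1988, (5.6.14) p.288] -/
theorem Fmbar_eq_taylorWithinEval (F : ℝ → E) (mbar : ℕ) :
    Fmbar F mbar = taylorWithinEval F mbar (Set.uIcc 0 1) 0 1 := by
  rw [Fmbar, taylor_within_apply]
  refine Finset.sum_congr rfl fun m _ => ?_
  rw [sub_zero, one_pow, mul_one, one_div]

/-- `F^{(m̄)} = F(0) + (orders 1 … m̄)`: the order-zero term is the value at `ũ_{k+1}` and the rest has the shape of `R̃`.
[cite: BalabanImbrieJaffe1988, (5.6.14) p.288] -/
theorem Fmbar_eq_add_Rtilde (F : ℝ → E) (mbar : ℕ) : Fmbar F mbar = F 0 + Rtilde F mbar := by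
  rw [Fmbar, Finset.sum_range_succ', Rtilde, add_comm]
  simp

/-- *"All remainder terms are in F̃_{k,loc}(X_σ)"*: for an `e′`-family of class `C^{m̄+1}` on `[0,1]`, `F̃` is the Taylor integral
remainder `∫₀¹ ((1−t)^{m̄}/m̄!) d^{m̄+1}F/de′^{m̄+1}(t) dt`. [cite: BalabanImbrieJaffe1988, (5.6.14) p.288] -/
theorem Ftilde_eq_integral [CompleteSpace E] {F : ℝ → E} {mbar : ℕ} (h : ContDiffOn ℝ (mbar + 1 : ℕ) F (Set.uIcc 0 1)) :
    Ftilde F mbar = ∫ t in (0 : ℝ)..1, ((1 - t) ^ mbar / mbar.factorial) • iteratedDerivWithin (mbar + 1) F (Set.uIcc 0 1) t := by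
  rw [Ftilde, Fmbar_eq_taylorWithinEval]
  exact taylor_integral_remainder h

/-- The order bookkeeping behind (5.6.13)/(5.6.14)₁: for the action family `S` of class `C^{n̄+1}` on `[0,1]`, the value at the full
field is the value at `ũ_{k+1}` plus `R̃^{(k)}` plus the remainder of order `> n̄` (*"terms of higher than n̄-th order in e_k are
irrelevant and will be treated separately"* — filed under `Σ_□W₁^{(k)}(□)` in (5.6.13)):
`S(1) = S(0) + R̃ + ∫₀¹ ((1−t)^{n̄}/n̄!) d^{n̄+1}S(t) dt`. [cite: BalabanImbrieJaffe1988, (5.6.13)–(5.6.14) p.288] -/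
theorem split_S [CompleteSpace E] {S : ℝ → E} {nbar : ℕ} (h : ContDiffOn ℝ (nbar + 1 : ℕ) S (Set.uIcc 0 1)) :
    S 1 = S 0 + Rtilde S nbar
      + ∫ t in (0 : ℝ)..1, ((1 - t) ^ nbar / nbar.factorial) • iteratedDerivWithin (nbar + 1) S (Set.uIcc 0 1) t := by
  rw [← Ftilde_eq_integral h, Ftilde, Fmbar_eq_add_Rtilde]
  abel

/-- The SHAPE of *"|F̃_{k,loc}(X_σ)| ≦ c(F)"*: a bound `C` on the `(m̄+1)`-st `e′`-derivative along the interpolation gives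
`‖F̃‖ ≤ C/m̄!` (the paper's `c(F)` comes from the inductive field bounds — not claimed). [cite: BalabanImbrieJaffe1988, (5.6.14) p.288] -/
theorem norm_Ftilde_le {F : ℝ → E} {mbar : ℕ} {C : ℝ} (h : ContDiffOn ℝ (mbar + 1 : ℕ) F (Set.uIcc 0 1))
    (hC : ∀ t ∈ Set.uIcc (0 : ℝ) 1, ‖iteratedDerivWithin (mbar + 1) F (Set.uIcc 0 1) t‖ ≤ C) :
    ‖Ftilde F mbar‖ ≤ C / mbar.factorial := by
  rw [Ftilde, Fmbar_eq_taylorWithinEval, Set.uIcc_of_le zero_le_one]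
  rw [Set.uIcc_of_le zero_le_one] at h hC
  have h' : ContDiffOn ℝ (mbar + 1) F (Set.Icc 0 1) := by exact_mod_cast h
  have hb := taylor_mean_remainder_bound (f := F) (a := 0) (b := 1) (x := 1) (n := mbar) zero_le_one h'
    ⟨zero_le_one, le_rfl⟩ hC
  simpa using hb

end Literature.MathematicalPhysics.QuantumFieldTheory.BalabanImbrieJaffe1984to88.BIJ88TaylorSplit5614

end
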